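import Summits.CriticalPhenomena.PercolationContinuityZ3.Theorems.PercNearOneGluingNoHeavyLowerTailSahiAllButOneCylinders
import Summits.CriticalPhenomena.PercolationContinuityZ3.Theorems.PercNearOneGluingNoHeavyLowerTailSahiCTCReduction

/-!
# `NoHeavyLowerTail` (crux stmt-CriticalPhenomena-4575), Sahi / Kahn positivity: the ALL-BUT-TWO slot (I) — the DICTIONARY between pattern
# probabilities and the generating-function polynomials of the c = 2 certificate programme

Support file (cell `prim-l12`, seat P3, gen 20; `--supports stmt-CriticalPhenomena-4575`).  No `sorry`, no named facts, standard axioms.  Memo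
`run/shared/lean/prim/prim-l12/FROM-prim-l12-p3-g20-*.md`.

This is the probabilistic identification announced (and deliberately left out) in `…SahiCTCReduction` (docstring of `N2gen`): for interior block
parameters `q` with closed-odds `r_i = (1 − q_i)/q_i` and `W = ∏ q_i` (`…SahiAllButOneCylinders`), every family `𝒴` of patterns has
  `w(𝒴) = W · GF(K_𝒴)(r)`   (`pr_eq_ev`),   `K_𝒴 = {C : (Cᶜ) ∈ 𝒴}` the family of CLOSED SETS of `𝒴` (`cx`; a down-set containing `∅` when `𝒴` is a
nonempty up-set), and for the ALL-BUT-TWO event `H = {at most two closed}` (`allButTwo`) the traces are the size-filtered families of the programme: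
`K_{H∩𝒴} ↝ smallFaces`, `K_{Hᶜ∩𝒴} ↝ bigFaces`, `K_{H∩𝒳∩𝒵} ↝ smallCommonFaces`, `K_{{=2}∩𝒳∩𝒵} ↝ commonEdges`, `K_H ↝ Θ`, `K_{Hᶜ} ↝ D`, `K_{=2} ↝ e₂`,
`K_⊤ ↝ Π` (`gf_cx_*`), with `W·Π(r) = 1` and `e₂(r) > 0`.  The companion file `…SahiAllButTwo` turns the rows (a), (o), (TC) of a reduced transport
certificate for `ρ₂ = μ(· | exactly two closed)` into polynomial inequalities at `r` ((TC) ⟺ `Ñ₂(K_𝒳,K_𝒵)(r) ≥ 0`).  Nothing is asserted about the crux.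
-/

noncomputable section

open scoped Classical

namespace Summit.CriticalPhenomena.PercolationContinuityZ3.Theorems

namespace SahiAllButTwo

open Finset MvPolynomial
open SahiHittingSlot SahiTransportCert SahiAllButOne SahiCTCForms SahiCTCGenFun
open Literature.Combinatorics.Sahi2008
open Literature.Probability.Percolation.DecisionTree (ind ind_of_mem ind_of_not_mem ind_nonneg)

variable {k : ℕ} (q : Fin k → unitInterval)

/-! ### Closed sets, the pattern events, the complex of a family -/

/-- The closed coordinates of a pattern (a pattern is its set of OPEN coordinates). [this work] -/
def closed (T : Set (Fin k)) : Finset (Fin k) := univ.filter fun i => i ∉ T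

/-- The ALL-BUT-TWO pattern event `Th_{k−2}^k`: at most two coordinates of the block are closed. [this work] -/
def allButTwo (k : ℕ) : Set (Set (Fin k)) := {T | #(closed T) ≤ 2}

/-- Exactly two coordinates closed (the support of the certificate `ρ₂`). [this work] -/
def exTwo (k : ℕ) : Set (Set (Fin k)) := {T | #(closed T) = 2}

/-- The complex of CLOSED SETS of a family of patterns: `K_𝒴 = {C : Cᶜ ∈ 𝒴}`. [this work] -/
def cx (𝒴 : Set (Set (Fin k))) : Finset (Finset (Fin k)) := univ.filter fun C => ((↑C : Set (Fin k))ᶜ) ∈ 𝒴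

/-- Evaluation of an integer polynomial at the closed-odds vector `r`. [this work] -/
def ev (P : MvPolynomial (Fin k) ℤ) : ℝ := eval₂ (Int.castRingHom ℝ) (r q) P

/-- `closed(Cᶜ) = C`. [this work] -/
theorem closed_compl (C : Finset (Fin k)) : closed ((↑C : Set (Fin k))ᶜ) = C := by
  ext i; simp [closed]

/-- `(closed T)ᶜ = T`. [this work] -/
theorem compl_closed (T : Set (Fin k)) : ((↑(closed T) : Set (Fin k))ᶜ) = T := by
  ext i; simp [closed]

/-- Membership in `K_𝒴`. [this work] -/
theorem mem_cx {𝒴 : Set (Set (Fin k))} {C : Finset (Fin k)} : C ∈ cx 𝒴 ↔ ((↑C : Set (Fin k))ᶜ) ∈ 𝒴 := by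
  simp [cx]

/-- The closed-set map is a bijection `patterns ≃ finsets`. [this work] -/
def closedEquiv : Set (Fin k) ≃ Finset (Fin k) where
  toFun := closed
  invFun C := (↑C : Set (Fin k))ᶜ
  left_inv := compl_closed
  right_inv := closed_compl

/-- `K_𝒴` is a down-set when `𝒴` is an up-set. [this work] -/
theorem isLowerSet_cx {𝒴 : Set (Set (Fin k))} (h𝒴 : IsUpperSet 𝒴) : IsLowerSet ((cx 𝒴 : Finset (Finset (Fin k))) : Set (Finset (Fin k))) := by
  intro C D hDC hC
  rw [mem_coe, mem_cx] at hC ⊢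
  exact h𝒴 (Set.compl_subset_compl.2 (Finset.coe_subset.2 hDC)) hC

/-- `∅ ∈ K_𝒴` when `𝒴` is a nonempty up-set. [this work] -/
theorem empty_mem_cx {𝒴 : Set (Set (Fin k))} (h𝒴 : IsUpperSet 𝒴) (hne : 𝒴.Nonempty) : ∅ ∈ cx 𝒴 := by
  rw [mem_cx, coe_empty, Set.compl_empty]
  exact h𝒴 (Set.subset_univ _) hne.some_mem

/-! ### Weights through the odds -/

section Interior

variable {q} (hq : ∀ i, 0 < (q i : ℝ) ∧ (q i : ℝ) < 1)
include hq

/-- `w(T) = W · ∏_{i closed in T} r_i`. [this work] -/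
theorem bw_eq_W_mul_prod (T : Set (Fin k)) : bernoulliWeight q T = W q * ∏ i ∈ closed T, r q i := by
  rw [bw_apply, W_eq, closed, prod_filter, ← prod_mul_distrib]
  refine prod_congr rfl fun i _ => ?_
  by_cases hi : i ∈ T
  · rw [if_pos hi, if_neg (not_not.2 hi), mul_one]
  · rw [if_neg hi, if_pos hi]
    have := q_mul_one_add_r hq i
    linarith

omit hq in
/-- The support of `1_C` is `C`. [this work] -/
theorem support_ind (C : Finset (Fin k)) : (ind C : Fin k →₀ ℕ).support = C := by
  ext i; rw [Finsupp.mem_support_iff, SahiCTCGenFun.ind_apply]; split_ifs with h <;> simp [h]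

omit hq in
/-- `GF(K)(r) = Σ_{C ∈ K} ∏_{i ∈ C} r_i`. [this work] -/
theorem ev_gf (K : Finset (Finset (Fin k))) : ev q (gf K) = ∑ C ∈ K, ∏ i ∈ C, r q i := by
  unfold ev gf
  rw [eval₂_sum]
  refine sum_congr rfl fun C _ => ?_
  rw [eval₂_monomial, map_one, one_mul, Finsupp.prod, support_ind]
  exact prod_congr rfl fun i hi => by rw [SahiCTCGenFun.ind_apply, if_pos hi, pow_one]

omit hq in
/-- `GF(K)(r) ≥ 0`. [this work] -/
theorem ev_gf_nonneg (hr : ∀ i, 0 ≤ r q i) (K : Finset (Finset (Fin k))) : 0 ≤ ev q (gf K) := by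
  rw [ev_gf]; exact sum_nonneg fun C _ => prod_nonneg fun i _ => hr i

/-- **THE DICTIONARY**: `w(𝒴) = W · GF(K_𝒴)(r)`. [this work] -/
theorem pr_eq_ev (𝒴 : Set (Set (Fin k))) : pr q 𝒴 = W q * ev q (gf (cx 𝒴)) := by
  rw [pr_eq_sum, ev_gf, cx, sum_filter, mul_sum]
  refine Fintype.sum_equiv closedEquiv _ _ fun T => ?_
  rw [bw_eq_W_mul_prod hq T]
  change _ = W q * if ((↑(closed T) : Set (Fin k))ᶜ) ∈ 𝒴 then ∏ i ∈ closed T, r q i else 0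
  rw [compl_closed]
  by_cases hT : T ∈ 𝒴
  · rw [ind_of_mem hT, mul_one, if_pos hT]
  · rw [ind_of_not_mem hT, mul_zero, if_neg hT, mul_zero]

/-- `W · Π(r) = 1`. [this work] -/
theorem W_mul_ev_PiP : W q * ev q PiP = 1 := by
  unfold PiP
  rw [ev_gf, ← Finset.prod_one_add, W_mul_prod hq]

/-- `e₂(r) > 0` when the block has at least two coordinates. [this work] -/
theorem ev_ee_two_pos (hk : 2 ≤ k) : 0 < ev q (ee 2 : MvPolynomial (Fin k) ℤ) := by
  unfold ee
  rw [ev_gf]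
  have h01 : ({⟨0, by omega⟩, ⟨1, by omega⟩} : Finset (Fin k)) ∈ (bySize (· = 2) : Finset (Finset (Fin k))) := by
    refine mem_filter.2 ⟨mem_powerset.2 (subset_univ _), ?_⟩
    rw [card_pair]; exact fun h => by simp [Fin.ext_iff] at h
  refine lt_of_lt_of_le ?_ (single_le_sum (f := fun C : Finset (Fin k) => ∏ i ∈ C, r q i) (fun C _ => prod_nonneg fun i _ => r_nonneg hq i) h01)
  exact prod_pos fun i _ => r_pos hq i

end Interior

/-! ### Traces of the all-but-two event as size-filtered families -/

/-- `#closed(Cᶜ) = #C`. [this work] -/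
theorem card_closed_compl (C : Finset (Fin k)) : #(closed ((↑C : Set (Fin k))ᶜ)) = #C := by rw [closed_compl]

/-- `K_{H ∩ 𝒴} = h(K_𝒴)`. [this work] -/
theorem gf_cx_allButTwo_inter (𝒴 : Set (Set (Fin k))) : gf (cx (allButTwo k ∩ 𝒴)) = gf (smallFaces (cx 𝒴)) := by
  congr 1; ext C
  simp only [mem_cx, smallFaces, allButTwo, Set.mem_inter_iff, Set.mem_setOf_eq, card_closed_compl, mem_filter, mem_powerset, subset_univ,
    true_and]

/-- `K_{Hᶜ ∩ 𝒴} = t(K_𝒴)`. [this work] -/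
theorem gf_cx_compl_inter (𝒴 : Set (Set (Fin k))) : gf (cx ((allButTwo k)ᶜ ∩ 𝒴)) = gf (bigFaces (cx 𝒴)) := by
  congr 1; ext C
  simp only [mem_cx, bigFaces, allButTwo, Set.mem_inter_iff, Set.mem_compl_iff, Set.mem_setOf_eq, card_closed_compl, mem_filter, mem_powerset,
    subset_univ, true_and, not_le]
  constructor
  · rintro ⟨h1, h2⟩; exact ⟨by omega, h2⟩
  · rintro ⟨h1, h2⟩; exact ⟨by omega, h2⟩

/-- `K_{H ∩ 𝒳 ∩ 𝒵} = h_Y(K_𝒳, K_𝒵)`. [this work] -/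
theorem gf_cx_allButTwo_inter₂ (𝒳 𝒵 : Set (Set (Fin k))) : gf (cx (allButTwo k ∩ (𝒳 ∩ 𝒵))) = gf (smallCommonFaces (cx 𝒳) (cx 𝒵)) := by
  congr 1; ext C
  simp only [mem_cx, smallCommonFaces, allButTwo, Set.mem_inter_iff, Set.mem_setOf_eq, card_closed_compl, mem_filter, mem_powerset, subset_univ,
    true_and]

/-- `K_{{=2} ∩ 𝒳 ∩ 𝒵} = E_Y(K_𝒳, K_𝒵)`. [this work] -/
theorem gf_cx_exTwo_inter₂ (𝒳 𝒵 : Set (Set (Fin k))) : gf (cx (exTwo k ∩ (𝒳 ∩ 𝒵))) = gf (commonEdges (cx 𝒳) (cx 𝒵)) := by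
  congr 1; ext C
  simp only [mem_cx, commonEdges, exTwo, Set.mem_inter_iff, Set.mem_setOf_eq, card_closed_compl, mem_filter, mem_powerset, subset_univ, true_and]

/-- `GF(K_𝒴) = h(K_𝒴) + t(K_𝒴)`. [this work] -/
theorem gf_cx_split (𝒴 : Set (Set (Fin k))) : gf (cx 𝒴) = gf (smallFaces (cx 𝒴)) + gf (bigFaces (cx 𝒴)) := by
  rw [← gf_union]
  · congr 1; ext C
    simp only [smallFaces, bigFaces, mem_union, mem_filter, mem_powerset, subset_univ, true_and]
    constructor
    · intro h; by_cases h2 : #C ≤ 2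
      · exact Or.inl ⟨h2, h⟩
      · exact Or.inr ⟨by omega, h⟩
    · rintro (⟨_, h⟩ | ⟨_, h⟩) <;> exact h
  · rw [disjoint_left]; intro C h1 h2
    have := (mem_filter.1 h1).2.1; have := (mem_filter.1 h2).2.1; omega

/-- `K_H = Θ`. [this work] -/
theorem gf_cx_allButTwo : gf (cx (allButTwo k)) = (Th : MvPolynomial (Fin k) ℤ) := by
  unfold Th bySize; congr 1; ext C
  simp only [mem_cx, allButTwo, Set.mem_setOf_eq, card_closed_compl, mem_filter, mem_powerset, subset_univ, true_and]

/-- `K_{Hᶜ} = D`. [this work] -/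
theorem gf_cx_compl : gf (cx (allButTwo k)ᶜ) = (Dd : MvPolynomial (Fin k) ℤ) := by
  unfold Dd bySize; congr 1; ext C
  simp only [mem_cx, allButTwo, Set.mem_compl_iff, Set.mem_setOf_eq, card_closed_compl, mem_filter, mem_powerset, subset_univ, true_and, not_le]
  omega

/-- `K_{=2} = e₂`. [this work] -/
theorem gf_cx_exTwo : gf (cx (exTwo k)) = (ee 2 : MvPolynomial (Fin k) ℤ) := by
  unfold ee bySize; congr 1; ext C
  simp only [mem_cx, exTwo, Set.mem_setOf_eq, card_closed_compl, mem_filter, mem_powerset, subset_univ, true_and]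

/-- `K_⊤ = Π`. [this work] -/
theorem gf_cx_univ : gf (cx (Set.univ : Set (Set (Fin k)))) = (PiP : MvPolynomial (Fin k) ℤ) := by
  unfold PiP; congr 1; ext C
  simp only [mem_cx, Set.mem_univ, mem_powerset, subset_univ]

/-- `{=2} ⊆ H`. [this work] -/
theorem exTwo_subset : exTwo k ⊆ allButTwo k := fun T (hT : #(closed T) = 2) => show #(closed T) ≤ 2 by omega

/-- `H` is an up-set. [this work] -/
theorem isUpperSet_allButTwo : IsUpperSet (allButTwo k) := by
  intro S T hST hS
  refine le_trans (card_le_card fun i hi => ?_) hS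
  rw [closed, mem_filter] at hi ⊢
  exact ⟨hi.1, fun h => hi.2 (hST h)⟩

end SahiAllButTwo

end Summit.CriticalPhenomena.PercolationContinuityZ3.Theorems
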